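import Mathlib.GroupTheory.Commensurable
import Mathlib.Algebra.Group.Subgroup.Pointwise
import Mathlib.GroupTheory.Subgroup.Centralizer
import Mathlib.Topology.Algebra.Group.ClosedSubgroup
import Mathlib.Topology.Algebra.OpenSubgroup
import Literature.AnabelianGeometry.AbsoluteAnabelian.ProfiniteTerminology
import Literature.AnabelianGeometry.Anabelioids.Basic

/-!
# [AbsTopII] Prop 1.3 (v), (vii) — the group-theoretic CORE of the printed proof

S. Mochizuki, *Topics in Absolute Anabelian Geometry II* [AbsTopII] (bib `MochizukiAbsTopII2013`;
locators = PDF pages of the kurims manuscript `paper:url-585b8d0ad0d9`), §1, Proposition 1.3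
"Basic Properties of Inertia and Decomposition Groups", statement pp. 11–12, proof pp. 12–17.

The printed proof DERIVES (vii) (p. 13) and (v) (p. 16) by pure group theory
from (ii)/(iii), from [CombGC] (= [Mzk13]) Prop 1.2 (i)(ii) (Mochizuki, *A combinatorial version of
the Grothendieck conjecture*, Tohoku Math. J. 59 (2007), Prop 1.2 p. 8; bib `MochizukiCombGC2007`),
from the GRAPHICITY of the outer action `H → Aut(𝔾)` of Def 1.2 (ii), and from "(iv) applied to
various open subgroups" (p. 16).  This proof-only file (no definitions) isolates that
group theory for ONE subgroup `A ≤ N ⊴ G` (`A` = a verticial / nodal / cuspidal subgroup,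
`N = Π_𝔾`, `G = Π_H`):

* §A generic lemmas (`N_G(K) ⊆ C_G(K)`, `K ⊆ C_G(K)` are abc-iut-L3's
  `Anabelioids.normalizer_le_commensurator` / `Anabelioids.le_commensurator`, reused): commensurability and intersection with a normal subgroup
  (`C_G(H) ⊆ C_G(H ∩ N)`); commensurators / centralisers computed inside a subgroup `L`
  (`subgroupOf` transfer); conjugates of centralisers; the topological adapter "closed and of
  finite index in `A₁` ⇒ open in `A₁`" linking the printed "open in" form of [CombGC] Prop 1.2 (i)
  to the finite-index form;
* §B the three printed steps: `N_G(A) ∩ N = A` ([CombGC] 1.2 (ii)); `C_G(A) = N_G(A)` (graphicity +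
  [CombGC] 1.2 (i)(ii)); hence `N_G(A)` (and `N_G(A) ∩ M` in `M`) commensurably terminal; the node
  clause `Z = N_G(A) ∩ M`; and the first half of (v): `N_G(A) = C_G(I) = N_G(I)` for
  `I = Z_G(A) ∩ M` infinite with "`I ∩ gIg⁻¹ ≠ 1 ⇒ gAg⁻¹ = A`".

The assembly at abc-iut-L4-t4's `DPSCData` / abc-iut-L4-t6's `DPSCIndexData` (conclusions literally
`DPSCData.Prop13vii`, `DPSCData.Prop13v`, `DPSCIndexData.Prop_1_3_v'`) is the companion file
`AbsTopII/InertiaDecompositionProofs.lean`.  Some §A lemmas have PRIVATE twins in abc-iut-L3's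
`SemiGraphs/CommensurabilityProofs3.lean` (not importable without the anabelioid stack); they are
re-proved here in the `AbsoluteAnabelian` namespace.  The cell's two spellings of conjugation of a
subgroup — t4's `MulAut.conj g • H` and Mathlib's `ConjAct.toConjAct g • H` (commensurator API) —
are definitionally equal and used interchangeably.  HONEST FRAMING: classical group theory;
nothing here bears on [IUTchIII] Cor 3.12.
-/

open scoped Pointwise

namespace Literature.AnabelianGeometry.AbsoluteAnabelian

universe u

/-! ## §A. Generic group theory -/

section GroupTheory

variable {G : Type u} [Group G]

/-- Commensurability passes to intersections with a fixed subgroup: `H ~ K ⇒ H ∩ N ~ K ∩ N` (the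
step behind "`D_e ⊆ C_{Π_H}(D_e) ⊆ C_{Π_H}(Π_e)`", p. 13, via `D_e ∩ Π_𝔾 = Π_e`).
[cite: MochizukiAbsTopII2013, Prop 1.3 (vii) proof p.13] -/
private theorem commensurable_inf_right {H K : Subgroup G} (h : Subgroup.Commensurable H K)
    (N : Subgroup G) : Subgroup.Commensurable (H ⊓ N) (K ⊓ N) := by
  have key : ∀ {H K : Subgroup G}, H.relIndex K ≠ 0 → (H ⊓ N).relIndex (K ⊓ N) ≠ 0 := by
    intro H K hHK
    have h1 : H.relIndex (K ⊓ N) ≠ 0 :=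
      fun h0 => hHK (Subgroup.relIndex_eq_zero_of_le_right inf_le_left h0)
    have h2 : H ⊓ (K ⊓ N) = (H ⊓ N) ⊓ (K ⊓ N) := by
      rw [← inf_assoc]; exact inf_inf_distrib_right H K N
    rwa [← Subgroup.inf_relIndex_right, h2, Subgroup.inf_relIndex_right] at h1
  exact ⟨key h.1, key h.2⟩

/-- Conjugating `H ∩ N` for a normal subgroup `N`. [folklore] -/
private theorem conjAct_smul_inf_normal (H N : Subgroup G) [hN : N.Normal] (g : G) :
    ConjAct.toConjAct g • (H ⊓ N) = ConjAct.toConjAct g • H ⊓ N := by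
  rw [Subgroup.smul_inf, hN.conjAct (ConjAct.toConjAct g)]

/-- For a normal subgroup `N`, whoever commensurates `H` commensurates `H ∩ N`:
`C_G(H) ⊆ C_G(H ∩ N)`. (Used on p. 13: "`D_e ⊆ C_{Π_H}(D_e) ⊆ C_{Π_H}(Π_e)`" via `D_e ∩ Π_𝔾 = Π_e`,
and on p. 16 for `D_v`.) [cite: MochizukiAbsTopII2013, Prop 1.3 (vii) proof p.13] -/
theorem commensurator_le_commensurator_inf_normal (H N : Subgroup G) [N.Normal] :
    Subgroup.Commensurable.commensurator H ≤ Subgroup.Commensurable.commensurator (H ⊓ N) := by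
  intro g hg
  rw [Subgroup.Commensurable.commensurator_mem_iff] at hg ⊢
  rw [conjAct_smul_inf_normal]
  exact commensurable_inf_right hg N

/-- If `K` is infinite and `H ∩ K` has finite index in `K`, then `H ∩ K ≠ 1` (the step from
"`g` commensurates `I_v`" to "`I_v ∩ g·I_v·g⁻¹ ≠ {1}`", p. 16, `I_v ≅ Ẑ^Σ` being infinite).
[cite: MochizukiAbsTopII2013, Prop 1.3 (v) proof p.16] -/
theorem inf_ne_bot_of_relIndex_ne_zero_of_infinite {H K : Subgroup G} [Infinite K]
    (h : H.relIndex K ≠ 0) : H ⊓ K ≠ ⊥ := by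
  intro hbot
  apply h
  rw [← Subgroup.inf_relIndex_right, hbot, Subgroup.relIndex_bot_left]
  exact Nat.card_eq_zero_of_infinite

/-! ### Transfer along `subgroupOf` (working inside a subgroup `L`) -/

/-- Conjugating inside `L` and then viewing in `G` is conjugating in `G` (for `K ≤ L`, `γ ∈ L`;
Mathlib's `Subgroup.conj_smul_subgroupOf` in the `ConjAct` spelling). [folklore] -/
private theorem conjAct_smul_subgroupOf {K L : Subgroup G} (hKL : K ≤ L) (γ : L) :
    ConjAct.toConjAct γ • K.subgroupOf L = (ConjAct.toConjAct (γ : G) • K).subgroupOf L :=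
  Subgroup.conj_smul_subgroupOf hKL γ

/-- Commensurability is insensitive to the ambient group: for `H, K ≤ L`, `H ~ K` inside `L` iff
`H ~ K` inside `G`. [folklore] -/
private theorem commensurable_subgroupOf_iff {H K L : Subgroup G} (hH : H ≤ L) (hK : K ≤ L) :
    Subgroup.Commensurable (H.subgroupOf L) (K.subgroupOf L) ↔ Subgroup.Commensurable H K := by
  unfold Subgroup.Commensurable
  rw [Subgroup.relIndex_subgroupOf hK, Subgroup.relIndex_subgroupOf hH]

/-- The commensurator computed inside `L` is the trace on `L` of the commensurator in `G`
(for `K ≤ L`): `γ ∈ C_L(K) ↔ γ ∈ C_G(K)` for `γ ∈ L`. [folklore] -/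
private theorem mem_commensurator_subgroupOf_iff {K L : Subgroup G} (hKL : K ≤ L) (γ : L) :
    γ ∈ Subgroup.Commensurable.commensurator (K.subgroupOf L) ↔
      (γ : G) ∈ Subgroup.Commensurable.commensurator K := by
  rw [Subgroup.Commensurable.commensurator_mem_iff, Subgroup.Commensurable.commensurator_mem_iff,
    conjAct_smul_subgroupOf hKL, commensurable_subgroupOf_iff _ hKL]
  exact Subgroup.conj_smul_le_of_le hKL γ

/-- `C_L(K) = C_G(K) ∩ L` viewed in `L`, for `K ≤ L` (the passage from `C_{Π_H}(I_v)` to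
`C_{Π_I}(I_v) = D_v ∩ Π_I`, p. 16). [cite: MochizukiAbsTopII2013, Prop 1.3 (v) proof p.16] -/
theorem commensurator_subgroupOf_eq {K L : Subgroup G} (hKL : K ≤ L) :
    Subgroup.Commensurable.commensurator (K.subgroupOf L) =
      (Subgroup.Commensurable.commensurator K ⊓ L).subgroupOf L := by
  ext γ
  rw [mem_commensurator_subgroupOf_iff hKL, Subgroup.mem_subgroupOf, Subgroup.mem_inf]
  exact ⟨fun h => ⟨h, γ.2⟩, fun h => h.1⟩

/-- Commensurable terminality of `K` INSIDE `L` (`K ≤ L`) says: an element of `L` commensurating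
`K` lies in `K`. [cite: MochizukiAbsAnab2004, Def 0.1 (iii) p.4] -/
theorem isCommensurablyTerminal_subgroupOf_iff {K L : Subgroup G} (hKL : K ≤ L) :
    IsCommensurablyTerminal (K.subgroupOf L) ↔
      Subgroup.Commensurable.commensurator K ⊓ L ≤ K := by
  rw [isCommensurablyTerminal_iff, commensurator_subgroupOf_eq hKL]
  constructor
  · intro h x hx
    have hx' : (⟨x, hx.2⟩ : L) ∈ (Subgroup.Commensurable.commensurator K ⊓ L).subgroupOf L := by
      rw [Subgroup.mem_subgroupOf]; exact hx
    rw [h, Subgroup.mem_subgroupOf] at hx'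
    exact hx'
  · intro h
    apply le_antisymm
    · intro x hx
      rw [Subgroup.mem_subgroupOf] at hx ⊢
      exact h hx
    · intro x hx
      rw [Subgroup.mem_subgroupOf] at hx ⊢
      exact ⟨Anabelioids.le_commensurator K hx, x.2⟩

/-- The centraliser computed inside `L` is the trace on `L` of the centraliser in `G` (`K ≤ L`):
`Z_L(K) = Z_G(K) ∩ L` (used for `Z_{Π_I}(I_v)`, p. 16).
[cite: MochizukiAbsTopII2013, Prop 1.3 (v) proof p.16] -/
theorem centralizer_subgroupOf_eq {K L : Subgroup G} (hKL : K ≤ L) :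
    Subgroup.centralizer ((K.subgroupOf L : Subgroup L) : Set L) =
      (Subgroup.centralizer (K : Set G) ⊓ L).subgroupOf L := by
  ext γ
  rw [Subgroup.mem_centralizer_iff, Subgroup.mem_subgroupOf, Subgroup.mem_inf,
    Subgroup.mem_centralizer_iff]
  constructor
  · intro h
    refine ⟨fun k hk => ?_, γ.2⟩
    have := h ⟨k, hKL hk⟩ (by rw [SetLike.mem_coe, Subgroup.mem_subgroupOf]; exact hk)
    exact congrArg Subtype.val this
  · rintro ⟨h, -⟩ k hk
    rw [SetLike.mem_coe, Subgroup.mem_subgroupOf] at hk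
    exact Subtype.ext (h k hk)

/-- Conjugation commutes with taking centralisers. [folklore] -/
private theorem conjAct_smul_centralizer (g : G) (K : Subgroup G) :
    ConjAct.toConjAct g • Subgroup.centralizer (K : Set G) =
      Subgroup.centralizer ((ConjAct.toConjAct g • K : Subgroup G) : Set G) := by
  ext x
  rw [Subgroup.mem_pointwise_smul_iff_inv_smul_mem, Subgroup.mem_centralizer_iff,
    Subgroup.mem_centralizer_iff]
  constructor
  · intro h m hm
    rw [SetLike.mem_coe, Subgroup.mem_pointwise_smul_iff_inv_smul_mem] at hm
    have e := h _ hm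
    rw [← smul_mul', ← smul_mul'] at e
    exact MulAction.injective _ e
  · intro h k hk
    have e := h (ConjAct.toConjAct g • k) (Subgroup.smul_mem_pointwise_smul _ _ _ hk)
    apply MulAction.injective (ConjAct.toConjAct g)
    simp only [smul_mul', smul_inv_smul]
    exact e

/-- If `Z ⊔ N = M` with `N` normal, every element of `M` is a product `z * n`. [folklore] -/
private theorem exists_mul_eq_of_sup_eq {Z N M : Subgroup G} [N.Normal] (h : Z ⊔ N = M) {x : G}
    (hx : x ∈ M) : ∃ z ∈ Z, ∃ n ∈ N, z * n = x := by
  rw [← h, Subgroup.mem_sup_of_normal_right] at hx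
  exact hx

/-! ### Topological adapter: "open in `A₁`" versus "of finite index in `A₁`" -/

/-- A conjugate of a closed subgroup of a topological group is closed ([CombGC] Def 1.1 (ii) p. 6:
"a vertex (respectively, edge) of `𝔾` determines, up to conjugation, a closed subgroup"; cf. the
twin `SemiGraphs.isClosed_conj_smul` of abc-iut-L3, stated for `ConjAct`).
[cite: MochizukiCombGC2007, Def 1.1(ii) p.6] -/
theorem isClosed_mulAut_conj_smul [TopologicalSpace G] [IsTopologicalGroup G] {A : Subgroup G}
    (hA : IsClosed (A : Set G)) (γ : G) : IsClosed ((MulAut.conj γ • A : Subgroup G) : Set G) := by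
  have h : ((MulAut.conj γ • A : Subgroup G) : Set G) = (fun x : G => γ⁻¹ * x * γ⁻¹⁻¹) ⁻¹' (A : Set G) := by
    ext x
    rw [SetLike.mem_coe, Subgroup.mem_pointwise_smul_iff_inv_smul_mem, ← map_inv, MulAut.smul_def,
      MulAut.conj_apply]
    rfl
  rw [h]
  exact hA.preimage (IsTopologicalGroup.continuous_conj γ⁻¹)

/-- [CombGC] Prop 1.2 (i) is printed with "`A₁ ∩ A₂` open in `A₁`"; for CLOSED `A₂` this follows from
"`A₁ ∩ A₂` of finite index in `A₁`" (a closed subgroup of finite index is open), so the open form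
of the hypothesis implies the finite-index form used in §B–§C. [cite: MochizukiCombGC2007, Prop 1.2(i) p.8] -/
theorem of_isOpen_inf_subgroupOf [TopologicalSpace G] [IsTopologicalGroup G] {A₁ A₂ : Subgroup G}
    (h₂ : IsClosed (A₂ : Set G)) {P : Prop}
    (h : IsOpen (((A₂ ⊓ A₁).subgroupOf A₁ : Subgroup A₁) : Set A₁) → P)
    (hidx : (A₂ ⊓ A₁).relIndex A₁ ≠ 0) : P := by
  apply h
  rw [Subgroup.inf_relIndex_right] at hidx
  haveI : (A₂.subgroupOf A₁).FiniteIndex := ⟨hidx⟩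
  have hcl : IsClosed ((A₂.subgroupOf A₁ : Subgroup A₁) : Set A₁) := by
    rw [Subgroup.coe_subgroupOf]
    exact h₂.preimage continuous_subtype_val
  rw [Subgroup.inf_subgroupOf_right]
  exact Subgroup.isOpen_of_isClosed_of_finiteIndex _ hcl

end GroupTheory

/-! ## §B. The abstract core of the printed arguments

Fix a group `G` (= `Π_H`), a normal subgroup `N` (= `Π_𝔾`), a family `A : ι → Subgroup G` of
subgroups of `N` (the verticial, or the nodal, or the cuspidal subgroups) and an index `i`.  The
three inputs of the printed proof of "`D = C_{Π_H}(Π_*) = N_{Π_H}(Π_*)` is commensurably terminal"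
(Prop 1.3 (v) p. 16 / (vii) p. 13) are:
* `Graphic` — every `G`-conjugate of `A i` is an `N`-conjugate of some `A j` (Def 1.2 (ii): the
  outer action of `H` on `Π_𝔾` comes from an action on the semi-graph of anabelioids `𝔾`);
* `OpenInterDetermines` — [CombGC] Prop 1.2 (i) in finite-index form: if `A i ∩ γ·(A j)·γ⁻¹`
  (`γ ∈ N`) has finite index in `A i`, then `i = j`;
* `CTin` — [CombGC] Prop 1.2 (ii): `A i` is commensurably terminal in `N`.
They are hypotheses of the theorems below (spelled out, no new definitions). -/

section Core

variable {G : Type u} [Group G] {N : Subgroup G} [N.Normal] {ι : Type*} (A : ι → Subgroup G)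

omit [N.Normal] in
/-- p. 13 / p. 16: "`D ∩ Π_𝔾 = Π_*` [cf. [Mzk13], Proposition 1.2, (ii)]" —
`N_G(A) ∩ N = A` for `A ≤ N` commensurably terminal in `N`.
[cite: MochizukiAbsTopII2013, Prop 1.3 (vii) proof p.13] -/
theorem normalizer_inf_eq_of_ctIn {A : Subgroup G} (hAN : A ≤ N)
    (hCT : Subgroup.Commensurable.commensurator A ⊓ N ≤ A) :
    Subgroup.normalizer (A : Set G) ⊓ N = A := by
  apply le_antisymm
  · exact le_trans (inf_le_inf_right N (Anabelioids.normalizer_le_commensurator A)) hCT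
  · exact le_inf Subgroup.le_normalizer hAN

omit [N.Normal] in
/-- p. 13 / p. 16: "by [Mzk13], Proposition 1.2, (i), it follows that
`C_{Π_H}(Π_*) = N_{Π_H}(Π_*)`" — from graphicity, [CombGC] Prop 1.2 (i) and (ii).
[cite: MochizukiAbsTopII2013, Prop 1.3 (vii) proof p.13] -/
theorem commensurator_eq_normalizer_of_graphic (i : ι) (hAN : A i ≤ N)
    (hGraphic : ∀ g : G, ∃ j : ι, ∃ γ ∈ N,
      ConjAct.toConjAct g • A i = ConjAct.toConjAct γ • A j)
    (hDet : ∀ (j : ι) (γ : G), γ ∈ N →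
      (ConjAct.toConjAct γ • A j ⊓ A i).relIndex (A i) ≠ 0 → j = i)
    (hCT : Subgroup.Commensurable.commensurator (A i) ⊓ N ≤ A i) :
    Subgroup.Commensurable.commensurator (A i) = Subgroup.normalizer (A i : Set G) := by
  refine le_antisymm ?_ (Anabelioids.normalizer_le_commensurator (A i))
  intro g hg
  rw [Subgroup.Commensurable.commensurator_mem_iff] at hg
  obtain ⟨j, γ, hγN, hgj⟩ := hGraphic g
  -- `γ·A_j·γ⁻¹ = g·A_i·g⁻¹` is commensurable with `A_i`, so `j = i` by [CombGC] Prop 1.2 (i)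
  have hcomm : Subgroup.Commensurable (ConjAct.toConjAct γ • A j) (A i) := hgj ▸ hg
  have hji : j = i :=
    hDet j γ hγN (by rw [Subgroup.inf_relIndex_right]; exact hcomm.1)
  subst hji
  -- hence `γ ∈ C_G(A_j) ∩ N ⊆ A_j`, so `γ` normalises `A_j`, and so does `g`
  have hγC : γ ∈ Subgroup.Commensurable.commensurator (A j) := by
    rw [Subgroup.Commensurable.commensurator_mem_iff]; exact hcomm
  have hγA : γ ∈ A j := hCT ⟨hγC, hγN⟩
  have hγfix : ConjAct.toConjAct γ • A j = A j :=
    Subgroup.conjAct_pointwise_smul_eq_self (Subgroup.le_normalizer hγA)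
  rw [hγfix] at hgj
  exact Subgroup.conjAct_pointwise_smul_iff.mp hgj

/-- p. 13 / p. 16: "thus, `D = C_{Π_H}(D) = C_{Π_H}(Π_*) = N_{Π_H}(Π_*)`" — the
normaliser is commensurably terminal once `C_G(A) = N_G(A)` and `N_G(A) ∩ N = A`.
[cite: MochizukiAbsTopII2013, Prop 1.3 (vii) proof p.13] -/
theorem isCommensurablyTerminal_normalizer_of {A : Subgroup G}
    (hCN : Subgroup.Commensurable.commensurator A = Subgroup.normalizer (A : Set G))
    (hDN : Subgroup.normalizer (A : Set G) ⊓ N = A) :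
    IsCommensurablyTerminal (Subgroup.normalizer (A : Set G)) := by
  refine ⟨le_antisymm ?_ (Anabelioids.le_commensurator _)⟩
  calc Subgroup.Commensurable.commensurator (Subgroup.normalizer (A : Set G))
      ≤ Subgroup.Commensurable.commensurator (Subgroup.normalizer (A : Set G) ⊓ N) :=
        commensurator_le_commensurator_inf_normal _ N
    _ = Subgroup.normalizer (A : Set G) := by rw [hDN, hCN]

/-- The same three lines restricted to a normal subgroup `M ⊇ N` (p. 16: "`D_v` (respectively,
`D_v ∩ Π_I`; …) is commensurably terminal in `Π_H` (respectively, `Π_I`; …)"): `N_G(A) ∩ M` is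
commensurably terminal in `M`. [cite: MochizukiAbsTopII2013, Prop 1.3 (v) proof p.16] -/
theorem isCommensurablyTerminal_normalizer_inf_subgroupOf {A : Subgroup G} (M : Subgroup G)
    [M.Normal] (hNM : N ≤ M)
    (hCN : Subgroup.Commensurable.commensurator A = Subgroup.normalizer (A : Set G))
    (hDN : Subgroup.normalizer (A : Set G) ⊓ N = A) :
    IsCommensurablyTerminal ((Subgroup.normalizer (A : Set G) ⊓ M).subgroupOf M) := by
  rw [isCommensurablyTerminal_subgroupOf_iff inf_le_right]
  have h1 : Subgroup.Commensurable.commensurator (Subgroup.normalizer (A : Set G) ⊓ M) ≤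
      Subgroup.normalizer (A : Set G) := by
    calc Subgroup.Commensurable.commensurator (Subgroup.normalizer (A : Set G) ⊓ M)
        ≤ Subgroup.Commensurable.commensurator (Subgroup.normalizer (A : Set G) ⊓ M ⊓ N) :=
          commensurator_le_commensurator_inf_normal _ N
      _ = Subgroup.normalizer (A : Set G) := by
          rw [inf_assoc, inf_eq_right.mpr hNM, hDN, hCN]
  exact inf_le_inf_right M h1

/-- p. 13 (node case of (vii)): "`I_e ⊆ … ⊆ C_{Π_I}(Π_e)`; thus `D_e ∩ Π_I = … = I_e`
follows from the fact that `I_e` surjects onto `I`, together with the commensurable terminality of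
`Π_e` in `Π_𝔾`" — abstractly: for `A ≤ Z ≤ N_G(A) ∩ M` with `Z · N = M` and `N_G(A) ∩ N = A`, one
has `Z = N_G(A) ∩ M`. [cite: MochizukiAbsTopII2013, Prop 1.3 (vii) proof p.13] -/
theorem eq_normalizer_inf_of_sup_eq {A Z M : Subgroup G} (hAZ : A ≤ Z)
    (hZ : Z ≤ Subgroup.normalizer (A : Set G) ⊓ M) (hZN : Z ⊔ N = M)
    (hDN : Subgroup.normalizer (A : Set G) ⊓ N = A) :
    Z = Subgroup.normalizer (A : Set G) ⊓ M := by
  refine le_antisymm hZ ?_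
  rintro g ⟨hgD, hgM⟩
  obtain ⟨z, hz, n, hn, rfl⟩ := exists_mul_eq_of_sup_eq hZN hgM
  have hnD : n ∈ Subgroup.normalizer (A : Set G) := by
    have hzD : z ∈ Subgroup.normalizer (A : Set G) := (hZ hz).1
    have := (Subgroup.normalizer (A : Set G)).mul_mem ((Subgroup.normalizer (A : Set G)).inv_mem hzD) hgD
    rwa [inv_mul_cancel_left] at this
  have hnA : n ∈ A := by rw [← hDN]; exact ⟨hnD, hn⟩
  exact Z.mul_mem hz (hAZ hnA)

/-- p. 16 (first half of (v)): "`N_{Π_H}(I_v) ⊆ C_{Π_H}(I_v) ⊆ N_{Π_H}(Π_v) = D_v` … `D_v =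
N_{Π_H}(Π_v) ⊆ N_{Π_H}(I_v)`, so `N_{Π_H}(I_v) = C_{Π_H}(I_v) = D_v`" — abstractly, for
`I := Z_G(A) ∩ M` (`M` normal) INFINITE and satisfying "(iv) at open subgroups":
`I ∩ g·I·g⁻¹ ≠ 1 ⇒ g·A·g⁻¹ = A`. [cite: MochizukiAbsTopII2013, Prop 1.3 (v) proof p.16] -/
theorem normalizer_eq_commensurator_and_normalizer_centralizer_inf {A M : Subgroup G} [M.Normal]
    [Infinite ↥(Subgroup.centralizer (A : Set G) ⊓ M)]
    (hL : ∀ g : G, ConjAct.toConjAct g • (Subgroup.centralizer (A : Set G) ⊓ M) ⊓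
        (Subgroup.centralizer (A : Set G) ⊓ M) ≠ ⊥ → ConjAct.toConjAct g • A = A) :
    Subgroup.normalizer (A : Set G) =
        Subgroup.Commensurable.commensurator (Subgroup.centralizer (A : Set G) ⊓ M) ∧
      Subgroup.normalizer (A : Set G) =
        Subgroup.normalizer ((Subgroup.centralizer (A : Set G) ⊓ M : Subgroup G) : Set G) := by
  set I : Subgroup G := Subgroup.centralizer (A : Set G) ⊓ M with hI
  -- `D ⊆ N(I)`
  have h1 : Subgroup.normalizer (A : Set G) ≤ Subgroup.normalizer (I : Set G) := by
    intro g hg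
    rw [← Subgroup.conjAct_pointwise_smul_iff]
    rw [hI, conjAct_smul_inf_normal, conjAct_smul_centralizer,
      Subgroup.conjAct_pointwise_smul_eq_self hg]
  -- `C(I) ⊆ D`
  have h3 : Subgroup.Commensurable.commensurator I ≤ Subgroup.normalizer (A : Set G) := by
    intro g hg
    rw [Subgroup.Commensurable.commensurator_mem_iff] at hg
    rw [← Subgroup.conjAct_pointwise_smul_iff]
    exact hL g (inf_ne_bot_of_relIndex_ne_zero_of_infinite hg.1)
  have h2 := Anabelioids.normalizer_le_commensurator I
  exact ⟨le_antisymm (h1.trans h2) h3, le_antisymm h1 (h2.trans h3)⟩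

end Core

end Literature.AnabelianGeometry.AbsoluteAnabelian
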